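import Summits.AtomisticToContinuum.BoseEinsteinCondensation.Theorems.BECGroundStateSOSPeriodicIRBoundDefs
import Summits.AtomisticToContinuum.BoseEinsteinCondensation.Theorems.BECGroundStateSOSPeriodicIRBoundLinearFloorOfLandau
import Summits.AtomisticToContinuum.BoseEinsteinCondensation.Theorems.BECGroundStateSOSPeriodicIRBoundTransferArith
import Summits.AtomisticToContinuum.BoseEinsteinCondensation.Theorems.BECGroundStateSOSPeriodicIRBoundHardCoreHalf
import Summits.AtomisticToContinuum.BoseEinsteinCondensation.Theorems.BECGroundStateSOSPeriodicIRBoundWFAssembly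
import Summits.AtomisticToContinuum.BoseEinsteinCondensation.Theorems.BECGroundStateSOSPeriodicIRBoundZeroMomentumGapBounded
import Summits.AtomisticToContinuum.BoseEinsteinCondensation.Theorems.BECGroundStateSOSPeriodicIRBoundZeroMomentumGapAEBounded
import Summits.AtomisticToContinuum.BoseEinsteinCondensation.Theorems.PeriodicIRBound.Negative.AEClass
import Summits.AtomisticToContinuum.BoseEinsteinCondensation.Theorems.BECGroundStateSOSPeriodicIRBoundWFPotCross
import Summits.AtomisticToContinuum.BoseEinsteinCondensation.Theorems.BECInsertionCorrectorStaticResponseBoundTruncationCompactness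
import Summits.AtomisticToContinuum.BoseEinsteinCondensation.Theorems.BECGroundStateSOSPeriodicIRBoundPFTwoMinimisers
import Summits.AtomisticToContinuum.BoseEinsteinCondensation.Theorems.BECGroundStateSOSPeriodicIRBoundPFFormUpperBound2
import Summits.AtomisticToContinuum.BoseEinsteinCondensation.Theorems.BECGroundStateSOSPeriodicIRBoundPFPositiveMain
import Summits.AtomisticToContinuum.BoseEinsteinCondensation.Theorems.BECGroundStateSOSPeriodicIRBoundPFMinimiserUnique2
import Summits.AtomisticToContinuum.BoseEinsteinCondensation.Theorems.BECGroundStateSOSPeriodicIRBoundZeroMomentumGapIntegrable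
import Literature.MathematicalPhysics.QuantumManyBody.PeriodicMaxFormApproximation
import Literature.MathematicalPhysics.QuantumManyBody.PeriodicGroundStateNondegenerateProofs
import Literature.MathematicalPhysics.QuantumManyBody.PeriodicFeynmanKacEnergyLower
import HarnessLib

/-!
# Line `linear-ph-floor-wagner` — checked skeleton for crux `PeriodicIRBound` (stmt-AtomisticToContinuum-3972)
# (lead's copy, v15 — seat c6, 2026-08-16T19:40Z: no reshape; re-verified rc 0 with the same 3 `stub_*` sorries; pooled stmt-9091 / stmt-9094 still open and unclaimed (ledger 14:06Z), 6b still unfiled, Disproof.lean unchanged since 05:27Z — no movement possible inside the line. v14 — seat c5, 2026-08-16T19:20Z: no reshape, re-verified rc 0 with the same 3 `stub_*` sorries against the current tree; state of the pooled items unchanged (stmt-9091, stmt-9094 open, unclaimed; 6b unfiled); crux parked `blocked-on: stmt-AtomisticToContinuum-9091` with ledger status `blocked` (upstream:stmt-AtomisticToContinuum-9091). v13 — seat c4, 2026-08-16: no reshape; open stubs unchanged = pooled stmt-9091, stmt-9094 + promoted 6b; stub 3a′ now IMPORTED from its landed module instead of re-derived inline; the standing reduction landed as importable theorems `…PeriodicIRBoundReductionIntegrable.lean`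 (p121190: integrable class ⟸ `C⁺` alone ⟸ stmt-9091 ∧ stmt-9094; crux BY NAME ⟸ `C⁺` ∧ 6b ⟸ stmt-9091 ∧ stmt-9094 ∧ 6b). v12 — seat c2: stub 3b′ (zero-momentum gap, integrable unbounded `v`) CLOSED: reshaped into the four registered stubs S-A `stub_fkFormUpperBoundIntegrable`, S-B `stub_fkPositiveOfMinimiser`, S-C1 `stub_twoMinimisersOfDegenerate`, S-C2 `stub_minimiserUniqueOfPositive` of an in-tree Perron–Frobenius proof (Feynman–Kac + truncation + Beurling–Deny on the maximal form), composed sorry-free into `nondegenerateFiniteRange_of_stubs` ⇒ 3b′; stubs 3a, 3a′, 4, 5b, 5c, 6, S-A (p107843), S-B (p108133), S-C1 (p106919), S-C2 landed and imported ⇒ 3b′ CLOSED; open: pooled 1, 2 and 6b = 3)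

Route `route-AtomisticToContinuum-BECGroundStateSOS`; crux decl
`Summit.AtomisticToContinuum.BoseEinsteinCondensation.Theses.BECGroundStateSOS.PeriodicIRBound`, concluded BY
NAME by `PeriodicIRBound_of` (§4) as a closed term over the NINE registered stubs of §3 (the Defs module's `periodicIRBound_of_inputs` is the same composition with the stubs as hypotheses). Planner's skeleton:
`Cruxes/PeriodicIRBound/Lines/linear-ph-floor-wagner.lean` (6 stubs); lead's reshape (2026-08-16): the planner's
`stub_transfer` (M/L) is split at the skeleton level into `stub_wagnerFeynman` (the analytic heart: the two-sided
moment bound for `groundOccupation` at fixed `(N,L)`, held by the lead) and `stub_transferArith` (window arithmetic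
+ the a.e.-free case), glued by the sorry-free `transfer_of`; all statements are named `Prop`s of §1–§2, which are
imported from the Defs module `Theorems/BECGroundStateSOSPeriodicIRBoundDefs.lean` (landed p81792); landed stubs are imported
from their `Theorems/BECGroundStateSOSPeriodicIRBound<Stub>.lean` files and their `sorry`s deleted here. Line card `Lines/linear-ph-floor-wagner.md`;
Disproof `Cruxes/PeriodicIRBound/Disproof.lean` §1–§20 (no kill) honoured as in the card (γ-form target, `∫v = ⊤`
split, δ after N, k ≠ 0, per-v constants).

Stubs (sizes): 1 `stub_landauSectorBound` = stmt-9091 (XL, open, POOLED) · 2 `stub_energyConvexity` = stmt-9094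
(M/open, POOLED) · 3a `stub_zeroMomentumGroundBounded` (bounded admissible `v`; PROVED by seat c1 from the tree's `PeriodicGroundStateNondegenerate_holds`, file `Theorems/BECGroundStateSOSPeriodicIRBoundZeroMomentumGapBounded.lean`, p96472) · 3a′ `stub_zeroMomentumGroundAEBounded` (essentially bounded `v`, a.e.-class transport of 3a; file `…ZeroMomentumGapAEBounded.lean`) · 3b′ `stub_zeroMomentumGroundUnbounded` (integrable, not essentially bounded `v` = the residual of POOLED stmt-11845) — since v11 a THEOREM from the NEW registered stubs S-A `stub_fkFormUpperBoundIntegrable` (M), S-B `stub_fkPositiveOfMinimiser` (L/XL, LEAD), S-C1 `stub_twoMinimisersOfDegenerate` (M), S-C2 `stub_minimiserUniqueOfPositive` (L): an in-tree Perron–Frobenius proof of `2E₀ < kyFanTwo` for finite-range integrable `v` (the named fact `PeriodicGroundStateNondegenerateIntegrable`, Reed–Simon IV Thm XIII.48(a) = Faris–Simon 1975, proposed to Literature as p104370, is its `Measurable`-only generalisation) · 4 `stub_linearFloor_of_landau :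
LinearFloorOfLandau` (S/M, provable now) · 5b `stub_wagnerFeynman : WagnerFeynmanBound` (L/XL Lean, no open
mathematics; LEAD) · 5c `stub_transferArith : TransferArith` (M) · 6 `stub_hardCore : HardCoreHalf` (M, window arithmetic after
the wave-1 reshape; proof ready) · 6b `stub_hardCoreWagnerFeynman : HardCoreWagnerFeynmanBound` (L/XL, fragile: the dressed
per-mode moment bound for non-integrable v).
-/

noncomputable section

open scoped BigOperators ENNReal
open Filter MeasureTheory

namespace Summit.AtomisticToContinuum.BoseEinsteinCondensation.Cruxes.PeriodicIRBound.LinearPhFloorWagner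

open Literature.MathematicalPhysics.QuantumManyBody.BoseGas
open Summit.AtomisticToContinuum.BoseEinsteinCondensation.Theses.BECGroundStateSOS (PeriodicIRBound)
open Summit.AtomisticToContinuum.BoseEinsteinCondensation.Theses.BECSectorPoincareTwoScale
  (LandauSectorBound EnergyConvexityWindow)
open Summit.AtomisticToContinuum.BoseEinsteinCondensation.Theses.BECNoCheapMomentum
  (ZeroMomentumGround SectorGapFloor)
open Summit.AtomisticToContinuum.BoseEinsteinCondensation.Theorems.PeriodicIRBound.Negative
  (IRBoundFor InWindow groundOccupation GroundIRBoundWith irBoundFor_iff_ground)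
open Literature.MathematicalPhysics.QuantumManyBody (PeriodicGroundStateNondegenerate_holds)
open scoped NNReal InnerProductSpace
open UnitAddTorus

-- The measure on `ℝ/ℤ` is the Haar PROBABILITY measure, as in `PeriodicFormDomain.lean` (stubs S-C1/S-C2 speak about
-- the maximal form on `L²((ℝ/ℤ)^{3N})`).
attribute [local instance] Literature.MathematicalPhysics.QuantumManyBody.BoseGas.formDomain_measureSpace
  Literature.MathematicalPhysics.QuantumManyBody.BoseGas.formDomain_isProbabilityMeasure
  Literature.MathematicalPhysics.QuantumManyBody.BoseGas.formDomain_isProbabilityMeasure_pi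


/-! ## §0  The lever: two-sided Markov / Wagner–Feynman bound (finite-dimensional shadow, PROVED) -/

section Wagner

variable {n : Type*} [Fintype n]

open Matrix

/-- Adjoint identity for the dot-product pairing: `⟨ψ, a w⟩ = ⟨aᴴ ψ, w⟩`. [folklore] -/
theorem star_dot_mulVec (a : Matrix n n ℂ) (ψ w : n → ℂ) :
    star ψ ⬝ᵥ (a *ᵥ w) = star (aᴴ *ᵥ ψ) ⬝ᵥ w := by
  rw [dotProduct_mulVec, star_mulVec, conjTranspose_conjTranspose]

/-- **Two-sided Markov / Wagner–Feynman bound (finite-dimensional shadow).** `H` Hermitian, `H ψ = E ψ`, `a`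
any operator. If the hole state `aψ` has mean energy `≥ E + ωm` and the particle state `aᴴψ` has mean energy
`≥ E + ωp`, then `ωm‖aψ‖² + ωp‖aᴴψ‖² ≤ ⟨ψ, [a,[H,aᴴ]] ψ⟩` — the chemical potentials of the two channels CANCEL.
The algebraic core of `stub_wagnerFeynman`. [Wagner1966; Stringari1995 §2.2 (16); PitaevskiiStringari1991]
(proof verbatim from `IdeatorSketch1.lean` §A, re-checked by triage r1-1) -/
theorem wagner_twoSided (H a : Matrix n n ℂ) (ψ : n → ℂ) (E ωm ωp : ℝ)
    (hH : H.IsHermitian) (hψ : H *ᵥ ψ = (E : ℂ) • ψ)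
    (hm : (E + ωm) * (star (a *ᵥ ψ) ⬝ᵥ (a *ᵥ ψ)).re ≤
      (star (a *ᵥ ψ) ⬝ᵥ (H *ᵥ (a *ᵥ ψ))).re)
    (hp : (E + ωp) * (star (aᴴ *ᵥ ψ) ⬝ᵥ (aᴴ *ᵥ ψ)).re ≤
      (star (aᴴ *ᵥ ψ) ⬝ᵥ (H *ᵥ (aᴴ *ᵥ ψ))).re) :
    ωm * (star (a *ᵥ ψ) ⬝ᵥ (a *ᵥ ψ)).re + ωp * (star (aᴴ *ᵥ ψ) ⬝ᵥ (aᴴ *ᵥ ψ)).re ≤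
      (star ψ ⬝ᵥ ((a * (H * aᴴ) - a * (aᴴ * H) - (H * aᴴ * a - aᴴ * (H * a))) *ᵥ ψ)).re := by
  have hHψ : ∀ w : n → ℂ, star ψ ⬝ᵥ (H *ᵥ w) = (E : ℂ) * (star ψ ⬝ᵥ w) := by
    intro w
    rw [star_dot_mulVec, hH.eq, hψ, star_smul, smul_dotProduct, smul_eq_mul,
      Complex.star_def, Complex.conj_ofReal]
  have h1 : star ψ ⬝ᵥ ((a * (H * aᴴ)) *ᵥ ψ) = star (aᴴ *ᵥ ψ) ⬝ᵥ (H *ᵥ (aᴴ *ᵥ ψ)) := by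
    rw [← mulVec_mulVec, ← mulVec_mulVec, star_dot_mulVec]
  have h2 : star ψ ⬝ᵥ ((a * (aᴴ * H)) *ᵥ ψ) = (E : ℂ) * (star (aᴴ *ᵥ ψ) ⬝ᵥ (aᴴ *ᵥ ψ)) := by
    rw [← mulVec_mulVec, ← mulVec_mulVec, hψ, mulVec_smul, mulVec_smul, dotProduct_smul,
      star_dot_mulVec, smul_eq_mul]
  have h3 : star ψ ⬝ᵥ ((H * aᴴ * a) *ᵥ ψ) = (E : ℂ) * (star (a *ᵥ ψ) ⬝ᵥ (a *ᵥ ψ)) := by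
    rw [← mulVec_mulVec, ← mulVec_mulVec, hHψ, star_dot_mulVec aᴴ, conjTranspose_conjTranspose]
  have h4 : star ψ ⬝ᵥ ((aᴴ * (H * a)) *ᵥ ψ) = star (a *ᵥ ψ) ⬝ᵥ (H *ᵥ (a *ᵥ ψ)) := by
    rw [← mulVec_mulVec, ← mulVec_mulVec, star_dot_mulVec aᴴ, conjTranspose_conjTranspose]
  rw [sub_mulVec, sub_mulVec, sub_mulVec, dotProduct_sub, dotProduct_sub, dotProduct_sub,
    h1, h2, h3, h4]
  simp only [Complex.sub_re, Complex.mul_re, Complex.ofReal_re, Complex.ofReal_im, zero_mul,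
    sub_zero]
  rw [add_mul] at hm hp
  linarith

end Wagner

/-! ## §3  Registered stubs (the only `sorry`s of the line)

Stubs 1–3 are VERBATIM items of sibling routes (pooling: they are served there and are not re-staffed from this
crux); stubs 4, 5b, 5c, 6 are this line's own obligations (statements in §2). -/

/-- **stub_landauSectorBound** — verbatim `BECSectorPoincareTwoScale.LandauSectorBound` = stmt-AtomisticToContinuum-9091
(rank-0 TARGET of that route; XL / open-problem strength: Landau's criterion as a linear `N`-sector floor
`θ√(ρa)|k|` on `|k| ≤ M₀√(ρa)` in the density window `ρ/2 ≤ N/L³ ≤ 2ρ`, hard cores admitted). POOLED: when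
stmt-9091 lands, replace this `sorry` by the landed theorem. The HARDEST stub. -/
theorem stub_landauSectorBound : LandauSectorBound := by
  sorry

/-- **stub_energyConvexity** — verbatim `BECSectorPoincareTwoScale.EnergyConvexityWindow` = stmt-AtomisticToContinuum-9094
(midpoint near-convexity of `N ↦ E₀^per(N,L)` with allowance `ε√(ρa)/L` in the density window). POOLED. -/
theorem stub_energyConvexity : EnergyConvexityWindow := by
  sorry

-- stub_zeroMomentumGroundBounded (stub 3a, seat c1): LANDED — `Theorems/BECGroundStateSOSPeriodicIRBoundZeroMomentumGapBounded.lean`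
-- (p96472; `ZeroMomentumGapFor v` for every BOUNDED admissible `v`, from `PeriodicGroundStateNondegenerate_holds`; imported).

-- stub_zeroMomentumGroundAEBounded (stub 3a′, seat c1): LANDED — `Theorems/BECGroundStateSOSPeriodicIRBoundZeroMomentumGapAEBounded.lean`
-- (p98062; `ZeroMomentumGapFor v` for every ESSENTIALLY bounded admissible `v`, a.e.-class transport of stub 3a; imported since v13).

-- stub_fkFormUpperBoundIntegrable (S-A): LANDED — `Theorems/BECGroundStateSOSPeriodicIRBoundPFFormUpperBound2.lean` (p107843; part 1 …PFFormUpperBound.lean p107159; wave-1 worker; imported).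

-- stub_fkPositiveOfMinimiser (S-B): LANDED — `Theorems/BECGroundStateSOSPeriodicIRBoundPFPositiveMain.lean` (p108133; parts …PFOpNorm p106887, …PFJensen p107299, …PFPositive p107689; lead; imported).

-- stub_twoMinimisersOfDegenerate (S-C1): LANDED — `Theorems/BECGroundStateSOSPeriodicIRBoundPFTwoMinimisers.lean` (p106919, wave-1 worker; imported).

-- stub_minimiserUniqueOfPositive (S-C2): LANDED — `Theorems/BECGroundStateSOSPeriodicIRBoundPFMinimiserUnique2.lean` (+ part 1 …PFMinimiserUnique.lean; wave-1 worker; imported).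

-- nondegenerateFiniteRange_of_stubs / stub_zeroMomentumGroundUnbounded (stub 3b′): LANDED — `Theorems/BECGroundStateSOSPeriodicIRBoundZeroMomentumGapIntegrable.lean`
-- (p115991: `two_mul_periodicGroundStateEnergy_lt_kyFanTwo`, `zeroMomentumGapFor_of_integrable`, `stub_zeroMomentumGroundUnbounded` UNCONDITIONAL,
-- `zeroMomentumGround_holds` = stmt-AtomisticToContinuum-11845 in full; composed from the landed S-A p107843, S-B p115724, S-C1 p106919, S-C2 p111501; imported).

/-- The pooled item stmt-11845 per potential, recovered from stubs 3a′/3b′ by cases on essential boundedness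
(so the composition below is unchanged in shape). -/
theorem zeroMomentumGapFor_of_stubs (v : ℝ → ℝ≥0∞) (hv : IsRepulsiveFiniteRange v)
    (hint : (∫⁻ x : Space, v ‖x‖) ≠ ⊤) : ZeroMomentumGapFor v := by
  by_cases hbdd : ∃ M : ℝ≥0∞, M ≠ ⊤ ∧ ∀ᵐ x : Space, v ‖x‖ ≤ M
  · exact stub_zeroMomentumGroundAEBounded v hv hbdd
  · exact stub_zeroMomentumGroundUnbounded v hv hint hbdd

-- stub_linearFloor_of_landau (stub 4): LANDED — `Theorems/BECGroundStateSOSPeriodicIRBoundLinearFloorOfLandau.lean` (imported).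

-- stub_wagnerFeynman (stub 5b, the lead's stub): LANDED — `Theorems/BECGroundStateSOSPeriodicIRBoundWFAssembly.lean` (+ 19 modules `…WF*.lean`; imported).

-- stub_transferArith (stub 5c): LANDED — `Theorems/BECGroundStateSOSPeriodicIRBoundTransferArith.lean` (imported).

-- stub_hardCore (stub 6): LANDED — `Theorems/BECGroundStateSOSPeriodicIRBoundHardCoreHalf.lean` (imported).

/-- **stub_hardCoreWagnerFeynman** (stub 6b, L/XL, the line's fragile content) — see `HardCoreWagnerFeynmanBound`. -/
theorem stub_hardCoreWagnerFeynman : HardCoreWagnerFeynmanBound := by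
  sorry

/-! ## §4  Composition (real proof; no `sorry` below this line) -/

/-- `C⁺` from the two pooled spectral/thermodynamic stubs. -/
theorem linearParticleHoleFloor_of_stubs : LinearParticleHoleFloor :=
  stub_linearFloor_of_landau stub_energyConvexity stub_landauSectorBound

/-- As a by-product the line closes BECNoCheapMomentum's crux stmt-11843 from the same stubs. -/
theorem sectorGapFloor_of_stubs : SectorGapFloor :=
  sectorGapFloor_of_linearParticleHoleFloor linearParticleHoleFloor_of_stubs

/-- The integrable half from stubs 5b, 5c. -/
theorem transfer_of_stubs : Transfer :=
  transfer_of stub_wagnerFeynman stub_transferArith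

/-- **The skeleton theorem: the crux `PeriodicIRBound`, concluded BY NAME**, as a closed term over the nine
registered stubs (`periodicIRBound_of_inputs`: unfold the crux to `∀ v admissible, IRBoundFor v`, pass to the
γ-form, split on `∫v = ⊤` versus `∫v < ⊤`; in the integrable branch the zero-momentum gap comes from stubs 3a′/3b′ by
cases on essential boundedness, `zeroMomentumGapFor_of_stubs`). -/
theorem PeriodicIRBound_of : PeriodicIRBound := by
  have hFloor : LinearParticleHoleFloor := linearParticleHoleFloor_of_stubs
  have hT : Transfer := transfer_of_stubs
  refine Summit.AtomisticToContinuum.BoseEinsteinCondensation.Theorems.PeriodicIRBound.Negative.periodicIRBound_iff.2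
    fun v hv => (irBoundFor_iff_ground v).2 ?_
  by_cases htop : (∫⁻ x : Space, v ‖x‖) = ⊤
  · exact stub_hardCore v hv htop (stub_hardCoreWagnerFeynman v hv htop)
      (hFloor v hv (ne_of_eq_of_ne htop ENNReal.top_ne_zero))
  · exact hT v hv htop (hFloor v hv) (zeroMomentumGapFor_of_stubs v hv htop)

-- Cross-check (v13, not imported here so that this workfile elaborates before the farm builds the new module): the composition
-- above is the landed three-input reduction `periodicIRBound_of_open_inputs_v12` of
-- `Theorems/BECGroundStateSOSPeriodicIRBoundReductionIntegrable.lean` (p121190) instantiated with the three open stubs, i.e.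
-- `periodicIRBound_of_open_inputs_v12 stub_landauSectorBound stub_energyConvexity stub_hardCoreWagnerFeynman : PeriodicIRBound`.

end Summit.AtomisticToContinuum.BoseEinsteinCondensation.Cruxes.PeriodicIRBound.LinearPhFloorWagner

end
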